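import Summits.QuantumFields.YangMills.Theorems.BalabanUVNodesN15KingModelSrcDivByParts
import Summits.QuantumFields.YangMills.Theorems.BalabanUVNodesN15TwoGridDressedDivergenceJunk
import HarnessLib

/-!
# BalabanUVNodes ∕ N15 — THE KING-MODEL RUNG, PROGRAMME Y (the dressed SOURCE-DIVERGENCE entry of the King jet), FILE 70c:
# THE LETTER-MISMATCH ROWS OF THE BY-PARTS BOOKKEEPING — behind ABSTRACT fronts `G′` (fine), `Ḡ` (coarse) with plain rows, one divergence-form row
# `G′∘N′∇′*_μ`, one η-defect row `𝔇(G′,Ḡ)` and one divergence-form cell-oscillation row `G′∘𝔇(M_g, M_ḡ)`, the transported difference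
# `P∘(𝕄̄ − 𝕄̄₁)∘Ȳ` of the TRUE coarse by-parts step `𝕄̄` (coarse letters `w̄ = c̄ − Σ_μ B̄_μ`, `ã̄_μ = ā_μ(· − ē_μ)`) and the FITTED one `𝕄̄₁` (block averages of the
# fine letters `w′`, `ã′_μ`) costs `C·r·A·L^{−K}` (+ `C·θ·r·A`) — ONE coarse factor `L^{−K}`, uniformly in the refinement `n`

WHO ∕ WHEN.  Cell `pub-ymgap`, seat `pub-ymgap-dag-n15-d` (R134, N15 NE2 s3 = King-model rung, g22); `--kind proof --supports stmt-QuantumFields-27366 --as helper`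
(K3⁸; count-neutral).  THEOREMS ONLY (0 `def`).  Over this seat's FILE 69 `…KingModelSrcDivByParts` (`bLetter_sub_coarseStepQuot`, `mulOp_shift_eq_conj`,
`symbOp_one_sub_sTinv_pow`, `sT_pow_comp_pull_eq`, `bbar_eq_blockAvg_coarseStepQuot`, `blockAvg_shift_pow`, `abs_shiftFit_le`, `abs_bLetter_le`), dag-n15-a's shift rows
(`TwoGrid.hasMaj_sTinv_pow_comp`, `hasMaj_sum_sTinv_pow_comp`, `hasMaj_smul_ofBlocks`, `hasMaj_mulOp_comp`, `hasMaj_mulOp_comp_pull`), `Gluing.hasMaj_diag_comp ∕ hasMaj_comp_diag`,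
`B11SectG.hasMaj_comp_exp`, `B6UnitTorusCarrier.rowSum_unitTorusGeo` BY NAME; nothing in the tree is modified.

WHY (this seat's ARCHITECTURE NOTE «ENTRY 2 LIVE BY PARTS», pub-ymgap INBOX l.43300).  In the by-parts form `Y = S_κ + 𝕄Y`, `𝕄 = G∘M_w + Σ_μ (G∘N∇_μ)∘M_{ã_μ}` (FILE 69) the
fine and the coarse runs carry DIFFERENT letters: the coarse partner of the fine letter `b′_μ = N′(a′_μ − a′_μ(·−e′_μ))` is `B̄_μ = N̄(ā_μ − ā_μ(·−ē_μ))` = the block average of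
the COARSE difference quotient `B′_μ = N̄(a′_μ − a′_μ(·−L^n e′_μ))`, not of `b′_μ`; and `ã̄_μ = ā_μ(·−ē_μ)` = the block average of `a′_μ(·−L^n e′_μ)`, not of `ã′_μ`.  The η-defect device
(`T4EtaRateDefect.idef_neumann_majorant_flat`) compares the fine step `𝕄′` with the FITTED coarse step `𝕄̄₁` (block averages of the fine letters, where the cell-oscillation rows
apply); the price is the transported mismatch `P∘(𝕄̄ − 𝕄̄₁)∘Ȳ`, and this file pays it: `ã̄_μ − blockAvg ã′_μ = blockAvg(a′(·−L^n e′) − a′(·−e′)) = O(r∕L^K)` (FILE 69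
`abs_shiftFit_le`) is a plain multiplier; `b′_μ − B′_μ = (L^n)⁻¹Σ_{j<L^n}(b′_μ − b′_μ(·−je′_μ))` (FILE 69 `bLetter_sub_coarseStepQuot`) is an average of fine SHIFT COMMUTATORS, and behind
the fine front each commutator `G′∘(M_b − S_{−j}M_bS_j)∘P = G′(1 − S_{−j})M_bP + G′S_{−j}M_b(1 − S_j)P` costs one `L^{−K}`: `G′(1 − S_{−j}) = −N′⁻¹·(G′N′∇′*_μ)∘Σ_{i<j}S_{−i}`
(`j∕N′ ≤ L^{−K}`) and `(1 − S_j)P = −M_θ∘P∘N̄∇̄_μ` with `0 ≤ θ ≤ L^{−K}` (FILE 69 `sT_pow_comp_pull_eq`) — the latter lands on the dressed mixed row `N̄∇̄_μȲ` (FILE 70b).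

WHAT.  §1 algebra (`hasMaj_pull_kingPrV`, `idef_finsum`, `blockAvg_finsum`).  §2 ★ `hasMaj_front_shiftCommutator` (one commutator: `2βc_re^{δ}·rA·L^{−K}`),
★ `hasMaj_front_mulOp_avg` (their average), ★ `hasMaj_pull_front_mulOp_blockAvg` (TERM B: `P∘Ḡ∘M_{blockAvg χ}∘Ȳ = G′M_χPȲ − G′𝔇(M_χ,M_χ̄)Ȳ − 𝔇(G′,Ḡ)M_χ̄Ȳ`),
`hasMaj_pull_frontFwd_mulOp` (TERM A).  The assembly at King's two-grid letters (`Σ_μ` TERM A + TERM B = `P∘(𝕄̄ − 𝕄̄₁)∘Ȳ`) and the device's step rows are FILE 70d.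

HONEST FRAMING ∕ LIMITS.  Count-neutral operator bookkeeping on King's two-grid 1-form carrier (template literature [King1986] (2.13)–(2.17) p.653; [Balaban1985BackgroundPropagators]
(3.52) p.400, (3.62)–(3.65) pp.402–403: SHAPES ∕ mechanism) — the fronts are abstract, the rows are hypotheses; NOT Bałaban's covariant `G(U)`.  NE2⁺ NOT PRINTED ∕ NOT proved; no
statement of record touched; N15 NOT discharged; K3⁸ OPEN; counts UNMOVED (typed 28∕28 · discharged 5∕27); one finite torus per index — NOT ℝ⁴ ∕ infinite volume ∕ OS ∕ mass gap ∕ Clay.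
-/

noncomputable section

open scoped BigOperators Matrix
open Finset

namespace Summit.QuantumFields.YangMills.BalabanUVNodes.N15.KingModel.SrcDiv

open Literature.MathematicalPhysics.QuantumFieldTheory.Balaban1983to89
open Literature.MathematicalPhysics.QuantumFieldTheory.Balaban1983to89.B11SectG (BlockNorm HasMaj hasMaj_comp_exp)
open Literature.MathematicalPhysics.QuantumFieldTheory.Balaban1983to89.B6RandomWalk (Triangle254)
open Literature.MathematicalPhysics.QuantumFieldTheory.Balaban1983to89.T4EtaRateDefect (idef idef_apply)
open Literature.MathematicalPhysics.QuantumFieldTheory.Balaban1983to89.T4EtaRateCoeffDefect (pull pull_apply blockAvg diagK hasMaj_pull)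
open Literature.MathematicalPhysics.QuantumFieldTheory.Balaban1983to89.B6Prop26Gluing (mulOp mulOp_apply)
open Literature.MathematicalPhysics.QuantumFieldTheory.Balaban1983to89.B5Prop11Plancherel (Tor fine unitVec)
open Literature.MathematicalPhysics.QuantumFieldTheory.King1986.Torus (blockOf tdistT tdistT_nonneg tdistT_triangle)
open Literature.MathematicalPhysics.QuantumFieldTheory.Balaban1983to89.B6UnitTorusCarrier (unitTorusGeo rowSum_unitTorusGeo unitTorusGeo_dist)
open Summit.QuantumFields.YangMills.BalabanUVNodes.N15.VectorPiece (kingPrV blkFine blkFine_comp_kingPrV bshiftEquiv)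
open Summit.QuantumFields.YangMills.BalabanUVNodes.N15.BackgroundLayer (fgrad)
open Summit.QuantumFields.YangMills.BalabanUVNodes.N15.TwoGrid (symbOp sD sT sTinv hasMaj_sTinv_pow_comp hasMaj_sum_sTinv_pow_comp hasMaj_smul_ofBlocks hasMaj_mulOp_comp
  hasMaj_mulOp_comp_pull)
open Summit.QuantumFields.YangMills.BalabanUVNodes.N15.Gluing (hasMaj_diag_comp hasMaj_comp_diag)
open Summit.QuantumFields.YangMills.BalabanUVNodes.N15.DerivDefect (hasMaj_finset_sum)
open Summit.QuantumFields.YangMills.BalabanUVNodes.N15.BackgroundModel (kappa_ofBlocks)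
open Summit.QuantumFields.YangMills.BalabanUVNodes.N15.BackgroundLayer (abs_blockAvg_le blockAvg_sub)

variable {d : ℕ} (L : ℕ) [NeZero L] (M : Fin (d + 1) → ℕ) [∀ μ, NeZero (M μ)] (K n : ℕ)

/-! ## §1 Algebra -/

/-- The prolongation `P = pull kingPrV` has the unit diagonal block majorant from King's coarse 1-form blocks to the fine unit blocks. [folklore] -/
theorem hasMaj_pull_kingPrV :
    HasMaj (BlockNorm.ofBlocks (unitTorusGeo L K M) (blkFine L K M))
      (BlockNorm.ofBlocks (unitTorusGeo L K M) (fun i : Tor (fine (L ^ n * L ^ K) M) × Fin (d + 1) => blockOf (L ^ n * L ^ K) M i.1))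
      (pull (kingPrV L K n M)) (diagK fun _ => (1 : ℝ)) := by
  rw [← blkFine_comp_kingPrV M L K n]
  exact hasMaj_pull (g := unitTorusGeo L K M) (blkFine L K M) (kingPrV L K n M)

omit [NeZero L] [∀ μ, NeZero (M μ)] in
/-- The intertwining defect of finite sums is the sum of the defects. [folklore] -/
theorem idef_finsum {ι F₁ F₂ F₁' F₂' : Type} [AddCommGroup F₁] [Module ℝ F₁] [AddCommGroup F₂] [Module ℝ F₂] [AddCommGroup F₁'] [Module ℝ F₁']
    [AddCommGroup F₂'] [Module ℝ F₂'] (s : Finset ι) (τ₁ : F₁ →ₗ[ℝ] F₁') (τ₂ : F₂ →ₗ[ℝ] F₂') (T' : ι → F₁' →ₗ[ℝ] F₂') (T : ι → F₁ →ₗ[ℝ] F₂) :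
    idef τ₁ τ₂ (∑ i ∈ s, T' i) (∑ i ∈ s, T i) = ∑ i ∈ s, idef τ₁ τ₂ (T' i) (T i) :=
  LinearMap.ext fun v => by
    simp only [idef_apply, LinearMap.coe_sum, Finset.sum_apply, map_sum, Finset.sum_sub_distrib]

omit [NeZero L] [∀ μ, NeZero (M μ)] in
/-- Block averages of finite sums. [folklore] -/
theorem blockAvg_finsum {ι X X' : Type} [Fintype X'] [DecidableEq X] (π : X' → X) (s : Finset ι) (f : ι → X' → ℝ) (x : X) :
    blockAvg π (fun x' => ∑ i ∈ s, f i x') x = ∑ i ∈ s, blockAvg π (f i) x := by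
  unfold blockAvg
  rw [Finset.sum_comm, Finset.sum_div]

/-! ## §2 One fine shift commutator behind the fine front, transported to King's coarse blocks -/

set_option maxHeartbeats 400000 in
/-- ★ **ONE SHIFT COMMUTATOR COSTS `L^{−K}`.**  Behind a fine front `G′` with plain row `βe^{−δd}` and divergence-form rows `G′∘N′∇′*_μ ≤ βe^{−δd}`, for a fine multiplier
`|f| ≤ r`, a coarse operator `Ȳ` with rows `Ȳ, N̄∇̄_μȲ ≤ Ae^{−δd}` and `j ≤ L^n`:
`G′∘(M_f − M_{f(·−je′_μ)})∘P∘Ȳ ≤ 2βc_r e^{δ}·rA·L^{−K}·e^{−(δ∕2)d}` — from `M_{f(·−je)} = S_{−j}M_fS_j`, `G′(1 − S_{−j}) = −N′⁻¹(G′N′∇′*_μ)Σ_{i<j}S_{−i}` (`j∕N′ ≤ L^{−K}`)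
and `(S_j − 1)P = M_θPN̄∇̄_μ`, `0 ≤ θ ≤ L^{−K}` (FILE 69). [cite: Balaban1985BackgroundPropagators, (3.62)–(3.65) pp.402–403 (mechanism); King1986, (2.16) p.653] -/
theorem hasMaj_front_shiftCommutator
    {G' : Module.End ℝ (Tor (fine (L ^ n * L ^ K) M) × Fin (d + 1) → ℝ)} {Y : Module.End ℝ (Tor (fine (L ^ K) M) × Fin (d + 1) → ℝ)}
    {β A δ r : ℝ} (hβ : 0 ≤ β) (hA : 0 ≤ A) (hδ : 0 < δ) (hr : 0 ≤ r) (hM2 : ∀ μ, 2 ≤ fine (L ^ K) M μ)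
    (hG' : HasMaj (BlockNorm.ofBlocks (unitTorusGeo L K M) (fun i : Tor (fine (L ^ n * L ^ K) M) × Fin (d + 1) => blockOf (L ^ n * L ^ K) M i.1))
      (BlockNorm.ofBlocks (unitTorusGeo L K M) (fun i : Tor (fine (L ^ n * L ^ K) M) × Fin (d + 1) => blockOf (L ^ n * L ^ K) M i.1)) G'
      (fun y y' => β * Real.exp (-(δ * tdistT M y y'))))
    (hS' : ∀ μ, HasMaj (BlockNorm.ofBlocks (unitTorusGeo L K M) (fun i : Tor (fine (L ^ n * L ^ K) M) × Fin (d + 1) => blockOf (L ^ n * L ^ K) M i.1))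
      (BlockNorm.ofBlocks (unitTorusGeo L K M) (fun i : Tor (fine (L ^ n * L ^ K) M) × Fin (d + 1) => blockOf (L ^ n * L ^ K) M i.1))
      (G' ∘ₗ symbOp M (L ^ n * L ^ K) (((L ^ n * L ^ K : ℕ) : ℝ) • (sTinv M (L ^ n * L ^ K) μ - 1))) (fun y y' => β * Real.exp (-(δ * tdistT M y y'))))
    (hY : HasMaj (BlockNorm.ofBlocks (unitTorusGeo L K M) (blkFine L K M)) (BlockNorm.ofBlocks (unitTorusGeo L K M) (blkFine L K M)) Y
      (fun y y' => A * Real.exp (-(δ * tdistT M y y'))))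
    (hDY : ∀ μ, HasMaj (BlockNorm.ofBlocks (unitTorusGeo L K M) (blkFine L K M)) (BlockNorm.ofBlocks (unitTorusGeo L K M) (blkFine L K M))
      (symbOp M (L ^ K) (sD M (L ^ K) μ ((L ^ K : ℕ) : ℝ)) ∘ₗ Y) (fun y y' => A * Real.exp (-(δ * tdistT M y y'))))
    (μ : Fin (d + 1)) {f : Tor (fine (L ^ n * L ^ K) M) × Fin (d + 1) → ℝ} (hf : ∀ p, |f p| ≤ r) {j : ℕ} (hj : j ≤ L ^ n) :
    HasMaj (BlockNorm.ofBlocks (unitTorusGeo L K M) (blkFine L K M))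
      (BlockNorm.ofBlocks (unitTorusGeo L K M) (fun i : Tor (fine (L ^ n * L ^ K) M) × Fin (d + 1) => blockOf (L ^ n * L ^ K) M i.1))
      (G' ∘ₗ (mulOp f - mulOp (fun p : Tor (fine (L ^ n * L ^ K) M) × Fin (d + 1) => f (p.1 - j • unitVec (fine (L ^ n * L ^ K) M) μ, p.2))) ∘ₗ
        pull (kingPrV L K n M) ∘ₗ Y)
      (fun y y' => 2 * β * B4Sect5Proof.latticeConst (d + 1) (δ / 2) * Real.exp δ * r * A * (((L ^ K : ℕ) : ℝ))⁻¹ * Real.exp (-(δ / 2 * tdistT M y y'))) := by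
  have hdd : ∀ a b : (unitTorusGeo L K M).Site, 0 ≤ (unitTorusGeo L K M).dist a b := fun a b => tdistT_nonneg M a b
  have htri : Triangle254 (unitTorusGeo L K M) := fun a b c => tdistT_triangle M a b c
  have hσ : 0 < δ / 2 := by positivity
  have hrow := rowSum_unitTorusGeo L K M hσ
  have hcr : 0 ≤ B4Sect5Proof.latticeConst (d + 1) (δ / 2) := B4Sect5Proof.latticeConst_nonneg (d + 1) hσ.le
  have hL0 : 0 < L := Nat.pos_of_ne_zero (NeZero.ne L)
  have hLK : 0 < L ^ K := pow_pos hL0 K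
  have hjN : j ≤ L ^ n * L ^ K := hj.trans (Nat.le_mul_of_pos_right _ hLK)
  have hNr : (0 : ℝ) < ((L ^ n * L ^ K : ℕ) : ℝ) := by positivity
  have hLKr : (0 : ℝ) < ((L ^ K : ℕ) : ℝ) := by positivity
  have hx : (0 : ℝ) ≤ (((L ^ K : ℕ) : ℝ))⁻¹ := inv_nonneg.mpr hLKr.le
  -- the coarse intertwiner of the forward shift (FILE 69): `S_j P = P + M_θ P N̄∇̄_μ`, `0 ≤ θ ≤ L^{−K}`
  obtain ⟨θ, hθ, hSP⟩ := sT_pow_comp_pull_eq L M K n hM2 μ hj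
  have hθ' : ∀ p, |θ p| ≤ (((L ^ K : ℕ) : ℝ))⁻¹ := fun p => by rw [abs_of_nonneg (hθ p).1]; exact (hθ p).2
  -- the fine front against `1 − S_{−j}` (FILE 69): `G′ − G′S_{−j} = −N′⁻¹·(G′N′∇′*_μ)∘Σ_{i<j}S_{−i}`
  have h1 : G' - G' ∘ₗ symbOp M (L ^ n * L ^ K) (sTinv M (L ^ n * L ^ K) μ ^ j)
      = -((((L ^ n * L ^ K : ℕ) : ℝ))⁻¹ • ((G' ∘ₗ symbOp M (L ^ n * L ^ K) (((L ^ n * L ^ K : ℕ) : ℝ) • (sTinv M (L ^ n * L ^ K) μ - 1))) ∘ₗ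
          symbOp M (L ^ n * L ^ K) (∑ i ∈ range j, sTinv M (L ^ n * L ^ K) μ ^ i))) := by
    calc G' - G' ∘ₗ symbOp M (L ^ n * L ^ K) (sTinv M (L ^ n * L ^ K) μ ^ j)
        = G' ∘ₗ (1 - symbOp M (L ^ n * L ^ K) (sTinv M (L ^ n * L ^ K) μ ^ j)) := by
          rw [LinearMap.comp_sub, Module.End.one_eq_id, LinearMap.comp_id]
      _ = G' ∘ₗ symbOp M (L ^ n * L ^ K) (1 - sTinv M (L ^ n * L ^ K) μ ^ j) := by rw [map_sub, map_one]
      _ = _ := by rw [symbOp_one_sub_sTinv_pow, LinearMap.comp_neg, LinearMap.comp_smul, Module.End.mul_eq_comp, ← LinearMap.comp_assoc]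
  -- piece 1: `R₁ = M_f P Ȳ ≤ rA e^{−δd}`, `Σ_{i<j}S_{−i}R₁ ≤ j·rA e^{δ} e^{−δd}`, the divergence-form front, the scalar `N′⁻¹`
  have hR₀ := hasMaj_diag_comp (g := unitTorusGeo L K M) (blkFine L K M) (fun _ => hr) (hasMaj_mulOp_comp_pull M K n hr hf) hY
  have hR₁ : HasMaj (BlockNorm.ofBlocks (unitTorusGeo L K M) (blkFine L K M))
      (BlockNorm.ofBlocks (unitTorusGeo L K M) (fun i : Tor (fine (L ^ n * L ^ K) M) × Fin (d + 1) => blockOf (L ^ n * L ^ K) M i.1))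
      (mulOp f ∘ₗ pull (kingPrV L K n M) ∘ₗ Y) (fun y y' => r * A * Real.exp (-(δ * tdistT M y y'))) :=
    (hR₀.mono fun y y' => le_of_eq (by ring)).congr fun v => rfl
  have hSum := hasMaj_sum_sTinv_pow_comp M (L ^ n * L ^ K) K (mul_nonneg hr hA) hδ.le μ hjN hR₁
  have hP1 := hasMaj_comp_exp htri hdd hrow hβ (by positivity : (0 : ℝ) ≤ (j : ℝ) * (r * A) * Real.exp δ) hσ.le (by linarith : δ / 2 ≤ δ)
    (by linarith : δ / 2 + δ / 2 ≤ δ) (hS' μ) (hSum.mono fun y y' => le_of_eq (by ring))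
  have hP1s := (hasMaj_smul_ofBlocks (g := unitTorusGeo L K M) (fun i : Tor (fine (L ^ n * L ^ K) M) × Fin (d + 1) => blockOf (L ^ n * L ^ K) M i.1)
    (fun y y' => by rw [kappa_ofBlocks]; positivity) ((((L ^ n * L ^ K : ℕ) : ℝ))⁻¹) hP1).neg
  -- piece 2: `R₂ = M_f M_θ P N̄∇̄_μȲ ≤ rA L^{−K} e^{−δd}`, the shift `S_{−j}`, the plain front
  have hPD := hasMaj_diag_comp (g := unitTorusGeo L K M) (blkFine L K M) (fun _ => zero_le_one) (hasMaj_pull_kingPrV L M K n) (hDY μ)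
  have hθP := hasMaj_mulOp_comp (g := unitTorusGeo L K M) (fun i : Tor (fine (L ^ n * L ^ K) M) × Fin (d + 1) => blockOf (L ^ n * L ^ K) M i.1)
    (fun y y' => by positivity) hx hθ' hPD
  have hR₂ := hasMaj_mulOp_comp (g := unitTorusGeo L K M) (fun i : Tor (fine (L ^ n * L ^ K) M) × Fin (d + 1) => blockOf (L ^ n * L ^ K) M i.1)
    (fun y y' => by positivity) hr hf hθP
  have hSR₂ := hasMaj_sTinv_pow_comp M K (L ^ n * L ^ K) (by positivity : (0 : ℝ) ≤ r * A * (((L ^ K : ℕ) : ℝ))⁻¹) hδ.le μ hjN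
    (hR₂.mono fun y y' => le_of_eq (by ring))
  have hP2 := hasMaj_comp_exp htri hdd hrow hβ (by positivity : (0 : ℝ) ≤ r * A * (((L ^ K : ℕ) : ℝ))⁻¹ * Real.exp δ) hσ.le (by linarith : δ / 2 ≤ δ)
    (by linarith : δ / 2 + δ / 2 ≤ δ) hG' (hSR₂.mono fun y y' => le_of_eq (by ring))
  -- assembly: the operator identity (pointwise) and the constant
  refine ((hP1s.sub hP2).congr fun v => ?_).mono fun y y' => ?_
  · have e1 := LinearMap.congr_fun h1 (mulOp f (pull (kingPrV L K n M) (Y v)))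
    have e2 := LinearMap.congr_fun hSP (Y v)
    simp only [LinearMap.sub_apply, LinearMap.comp_apply, LinearMap.neg_apply, LinearMap.smul_apply, LinearMap.add_apply] at e1 e2 ⊢
    rw [mulOp_shift_eq_conj]
    simp only [LinearMap.comp_apply]
    rw [e2, map_add, map_add, map_sub, map_add, ← e1]
    abel
  · have hq : (((L ^ n * L ^ K : ℕ) : ℝ))⁻¹ * (j : ℝ) ≤ (((L ^ K : ℕ) : ℝ))⁻¹ := by
      have hℓr : (0 : ℝ) < ((L ^ n : ℕ) : ℝ) := by positivity
      rw [Nat.cast_mul, inv_mul_eq_div, div_le_iff₀ (by positivity)]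
      calc (j : ℝ) ≤ ((L ^ n : ℕ) : ℝ) := by exact_mod_cast hj
        _ = (((L ^ K : ℕ) : ℝ))⁻¹ * (((L ^ n : ℕ) : ℝ) * ((L ^ K : ℕ) : ℝ)) := by field_simp
    rw [kappa_ofBlocks, abs_of_nonneg (inv_nonneg.mpr hNr.le), unitTorusGeo_dist]
    have hE := Real.exp_nonneg (-(δ / 2 * tdistT M y y'))
    have hX : 0 ≤ β * B4Sect5Proof.latticeConst (d + 1) (δ / 2) * Real.exp δ * r * A * Real.exp (-(δ / 2 * tdistT M y y')) := by positivity
    calc (((L ^ n * L ^ K : ℕ) : ℝ))⁻¹ * (1 * β * ((j : ℝ) * (r * A) * Real.exp δ) * B4Sect5Proof.latticeConst (d + 1) (δ / 2) * Real.exp (-(δ / 2 * tdistT M y y')))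
          + 1 * β * (r * A * (((L ^ K : ℕ) : ℝ))⁻¹ * Real.exp δ) * B4Sect5Proof.latticeConst (d + 1) (δ / 2) * Real.exp (-(δ / 2 * tdistT M y y'))
        = β * B4Sect5Proof.latticeConst (d + 1) (δ / 2) * Real.exp δ * r * A * Real.exp (-(δ / 2 * tdistT M y y')) * ((((L ^ n * L ^ K : ℕ) : ℝ))⁻¹ * (j : ℝ))
          + β * B4Sect5Proof.latticeConst (d + 1) (δ / 2) * Real.exp δ * r * A * Real.exp (-(δ / 2 * tdistT M y y')) * (((L ^ K : ℕ) : ℝ))⁻¹ := by ring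
      _ ≤ β * B4Sect5Proof.latticeConst (d + 1) (δ / 2) * Real.exp δ * r * A * Real.exp (-(δ / 2 * tdistT M y y')) * (((L ^ K : ℕ) : ℝ))⁻¹
          + β * B4Sect5Proof.latticeConst (d + 1) (δ / 2) * Real.exp δ * r * A * Real.exp (-(δ / 2 * tdistT M y y')) * (((L ^ K : ℕ) : ℝ))⁻¹ :=
          add_le_add (mul_le_mul_of_nonneg_left hq hX) le_rfl
      _ = _ := by ring

/-- ★ **THE AVERAGE OF THE SHIFT COMMUTATORS** (`χ = (L^n)⁻¹Σ_{j<L^n}(f − f(·−je′_μ))`, e.g. `χ = b′_μ − B′_μ` by FILE 69 `bLetter_sub_coarseStepQuot`):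
`G′∘M_χ∘P∘Ȳ ≤ 2βc_r e^{δ}·rA·L^{−K}·e^{−(δ∕2)d}`. [cite: Balaban1985BackgroundPropagators, (3.62)–(3.65) pp.402–403 (mechanism); King1986, (2.16) p.653] -/
theorem hasMaj_front_mulOp_avg
    {G' : Module.End ℝ (Tor (fine (L ^ n * L ^ K) M) × Fin (d + 1) → ℝ)} {Y : Module.End ℝ (Tor (fine (L ^ K) M) × Fin (d + 1) → ℝ)}
    {β A δ r : ℝ} (hβ : 0 ≤ β) (hA : 0 ≤ A) (hδ : 0 < δ) (hr : 0 ≤ r) (hM2 : ∀ μ, 2 ≤ fine (L ^ K) M μ)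
    (hG' : HasMaj (BlockNorm.ofBlocks (unitTorusGeo L K M) (fun i : Tor (fine (L ^ n * L ^ K) M) × Fin (d + 1) => blockOf (L ^ n * L ^ K) M i.1))
      (BlockNorm.ofBlocks (unitTorusGeo L K M) (fun i : Tor (fine (L ^ n * L ^ K) M) × Fin (d + 1) => blockOf (L ^ n * L ^ K) M i.1)) G'
      (fun y y' => β * Real.exp (-(δ * tdistT M y y'))))
    (hS' : ∀ μ, HasMaj (BlockNorm.ofBlocks (unitTorusGeo L K M) (fun i : Tor (fine (L ^ n * L ^ K) M) × Fin (d + 1) => blockOf (L ^ n * L ^ K) M i.1))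
      (BlockNorm.ofBlocks (unitTorusGeo L K M) (fun i : Tor (fine (L ^ n * L ^ K) M) × Fin (d + 1) => blockOf (L ^ n * L ^ K) M i.1))
      (G' ∘ₗ symbOp M (L ^ n * L ^ K) (((L ^ n * L ^ K : ℕ) : ℝ) • (sTinv M (L ^ n * L ^ K) μ - 1))) (fun y y' => β * Real.exp (-(δ * tdistT M y y'))))
    (hY : HasMaj (BlockNorm.ofBlocks (unitTorusGeo L K M) (blkFine L K M)) (BlockNorm.ofBlocks (unitTorusGeo L K M) (blkFine L K M)) Y
      (fun y y' => A * Real.exp (-(δ * tdistT M y y'))))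
    (hDY : ∀ μ, HasMaj (BlockNorm.ofBlocks (unitTorusGeo L K M) (blkFine L K M)) (BlockNorm.ofBlocks (unitTorusGeo L K M) (blkFine L K M))
      (symbOp M (L ^ K) (sD M (L ^ K) μ ((L ^ K : ℕ) : ℝ)) ∘ₗ Y) (fun y y' => A * Real.exp (-(δ * tdistT M y y'))))
    (μ : Fin (d + 1)) {f : Tor (fine (L ^ n * L ^ K) M) × Fin (d + 1) → ℝ} (hf : ∀ p, |f p| ≤ r) {χ : Tor (fine (L ^ n * L ^ K) M) × Fin (d + 1) → ℝ}
    (hχ : ∀ p, χ p = (((L ^ n : ℕ) : ℝ))⁻¹ * ∑ j ∈ range (L ^ n), (f p - f (p.1 - j • unitVec (fine (L ^ n * L ^ K) M) μ, p.2))) :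
    HasMaj (BlockNorm.ofBlocks (unitTorusGeo L K M) (blkFine L K M))
      (BlockNorm.ofBlocks (unitTorusGeo L K M) (fun i : Tor (fine (L ^ n * L ^ K) M) × Fin (d + 1) => blockOf (L ^ n * L ^ K) M i.1))
      (G' ∘ₗ mulOp χ ∘ₗ pull (kingPrV L K n M) ∘ₗ Y)
      (fun y y' => 2 * β * B4Sect5Proof.latticeConst (d + 1) (δ / 2) * Real.exp δ * r * A * (((L ^ K : ℕ) : ℝ))⁻¹ * Real.exp (-(δ / 2 * tdistT M y y'))) := by
  have hL0 : 0 < L := Nat.pos_of_ne_zero (NeZero.ne L)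
  have hℓ : 0 < L ^ n := pow_pos hL0 n
  have hℓr : (0 : ℝ) < ((L ^ n : ℕ) : ℝ) := by positivity
  have hσ : 0 < δ / 2 := by positivity
  have hcr : 0 ≤ B4Sect5Proof.latticeConst (d + 1) (δ / 2) := B4Sect5Proof.latticeConst_nonneg (d + 1) hσ.le
  have hx : (0 : ℝ) ≤ (((L ^ K : ℕ) : ℝ))⁻¹ := inv_nonneg.mpr (by positivity)
  -- the commutators, summed over `j < L^n` and divided by `L^n`
  have hsum := hasMaj_finset_sum (g := unitTorusGeo L K M) (range (L ^ n)) fun j hj =>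
    hasMaj_front_shiftCommutator L M K n hβ hA hδ hr hM2 hG' hS' hY hDY μ hf (mem_range.mp hj).le
  have havg := hasMaj_smul_ofBlocks (g := unitTorusGeo L K M) (fun i : Tor (fine (L ^ n * L ^ K) M) × Fin (d + 1) => blockOf (L ^ n * L ^ K) M i.1)
    (fun y y' => Finset.sum_nonneg fun j _ => by positivity) ((((L ^ n : ℕ) : ℝ))⁻¹) hsum
  -- `M_χ = (L^n)⁻¹ Σ_j (M_f − M_{f(·−je)})`
  have hop : mulOp χ = (((L ^ n : ℕ) : ℝ))⁻¹ • ∑ j ∈ range (L ^ n),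
      (mulOp f - mulOp (fun p : Tor (fine (L ^ n * L ^ K) M) × Fin (d + 1) => f (p.1 - j • unitVec (fine (L ^ n * L ^ K) M) μ, p.2))) := by
    refine LinearMap.ext fun w => funext fun p => ?_
    simp only [mulOp_apply, LinearMap.smul_apply, LinearMap.coe_sum, Finset.sum_apply, Pi.smul_apply, LinearMap.sub_apply, Pi.sub_apply,
      smul_eq_mul, hχ]
    rw [mul_assoc, Finset.sum_mul]
    exact congrArg _ (Finset.sum_congr rfl fun j _ => by ring)
  refine (havg.congr fun v => ?_).mono fun y y' => ?_
  · simp only [LinearMap.smul_apply, LinearMap.coe_sum, Finset.sum_apply, LinearMap.comp_apply]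
    rw [hop]
    simp only [LinearMap.smul_apply, LinearMap.coe_sum, Finset.sum_apply, map_smul, map_sum]
  · rw [Finset.sum_const, card_range, nsmul_eq_mul, abs_of_nonneg (inv_nonneg.mpr hℓr.le), ← mul_assoc, inv_mul_cancel₀ hℓr.ne', one_mul]

/-- ★ **TERM B — THE TRUE-VERSUS-FITTED `b`-LETTER BEHIND THE COARSE FRONT.**  With `χ` as above (`|f| ≤ r`, so `|χ| ≤ 2r`), a coarse front `Ḡ` with η-defect row `𝔇(G′,Ḡ) ≤ βθe^{−δd}`
and the fine front's divergence-form cell-oscillation row `G′∘𝔇(M_g,M_{ḡ}) ≤ βs·L^{−K}e^{−δd}` (`|g| ≤ s`):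
`P∘Ḡ∘M_{χ̄}∘Ȳ = G′M_χPȲ − G′𝔇(M_χ,M_χ̄)Ȳ − 𝔇(G′,Ḡ)M_χ̄Ȳ ≤ 2βc_r·rA·((e^{δ} + 1)L^{−K} + θ)·e^{−(δ∕2)d}`.
[cite: Balaban1985BackgroundPropagators, (3.62)–(3.65) pp.402–403 (mechanism); King1986, Prop. 3.9 (3.73) p.665 (rate factor)] -/
theorem hasMaj_pull_front_mulOp_blockAvg
    {G' : Module.End ℝ (Tor (fine (L ^ n * L ^ K) M) × Fin (d + 1) → ℝ)} {Gc Y : Module.End ℝ (Tor (fine (L ^ K) M) × Fin (d + 1) → ℝ)}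
    {β A θ δ r : ℝ} (hβ : 0 ≤ β) (hA : 0 ≤ A) (hθ : 0 ≤ θ) (hδ : 0 < δ) (hr : 0 ≤ r) (hM2 : ∀ μ, 2 ≤ fine (L ^ K) M μ)
    (hG' : HasMaj (BlockNorm.ofBlocks (unitTorusGeo L K M) (fun i : Tor (fine (L ^ n * L ^ K) M) × Fin (d + 1) => blockOf (L ^ n * L ^ K) M i.1))
      (BlockNorm.ofBlocks (unitTorusGeo L K M) (fun i : Tor (fine (L ^ n * L ^ K) M) × Fin (d + 1) => blockOf (L ^ n * L ^ K) M i.1)) G'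
      (fun y y' => β * Real.exp (-(δ * tdistT M y y'))))
    (hS' : ∀ μ, HasMaj (BlockNorm.ofBlocks (unitTorusGeo L K M) (fun i : Tor (fine (L ^ n * L ^ K) M) × Fin (d + 1) => blockOf (L ^ n * L ^ K) M i.1))
      (BlockNorm.ofBlocks (unitTorusGeo L K M) (fun i : Tor (fine (L ^ n * L ^ K) M) × Fin (d + 1) => blockOf (L ^ n * L ^ K) M i.1))
      (G' ∘ₗ symbOp M (L ^ n * L ^ K) (((L ^ n * L ^ K : ℕ) : ℝ) • (sTinv M (L ^ n * L ^ K) μ - 1))) (fun y y' => β * Real.exp (-(δ * tdistT M y y'))))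
    (hY : HasMaj (BlockNorm.ofBlocks (unitTorusGeo L K M) (blkFine L K M)) (BlockNorm.ofBlocks (unitTorusGeo L K M) (blkFine L K M)) Y
      (fun y y' => A * Real.exp (-(δ * tdistT M y y'))))
    (hDY : ∀ μ, HasMaj (BlockNorm.ofBlocks (unitTorusGeo L K M) (blkFine L K M)) (BlockNorm.ofBlocks (unitTorusGeo L K M) (blkFine L K M))
      (symbOp M (L ^ K) (sD M (L ^ K) μ ((L ^ K : ℕ) : ℝ)) ∘ₗ Y) (fun y y' => A * Real.exp (-(δ * tdistT M y y'))))
    (hDG : HasMaj (BlockNorm.ofBlocks (unitTorusGeo L K M) (blkFine L K M))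
      (BlockNorm.ofBlocks (unitTorusGeo L K M) (fun i : Tor (fine (L ^ n * L ^ K) M) × Fin (d + 1) => blockOf (L ^ n * L ^ K) M i.1))
      (idef (pull (kingPrV L K n M)) (pull (kingPrV L K n M)) G' Gc) (fun y y' => β * θ * Real.exp (-(δ * tdistT M y y'))))
    (hGc : ∀ (g : Tor (fine (L ^ n * L ^ K) M) × Fin (d + 1) → ℝ) (s : ℝ), 0 ≤ s → (∀ p, |g p| ≤ s) →
      HasMaj (BlockNorm.ofBlocks (unitTorusGeo L K M) (blkFine L K M))
        (BlockNorm.ofBlocks (unitTorusGeo L K M) (fun i : Tor (fine (L ^ n * L ^ K) M) × Fin (d + 1) => blockOf (L ^ n * L ^ K) M i.1))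
        (G' ∘ₗ idef (pull (kingPrV L K n M)) (pull (kingPrV L K n M)) (mulOp g) (mulOp (blockAvg (kingPrV L K n M) g)))
        (fun y y' => β * s * (((L ^ K : ℕ) : ℝ))⁻¹ * Real.exp (-(δ * tdistT M y y'))))
    (μ : Fin (d + 1)) {f : Tor (fine (L ^ n * L ^ K) M) × Fin (d + 1) → ℝ} (hf : ∀ p, |f p| ≤ r) {χ : Tor (fine (L ^ n * L ^ K) M) × Fin (d + 1) → ℝ}
    (hχ : ∀ p, χ p = (((L ^ n : ℕ) : ℝ))⁻¹ * ∑ j ∈ range (L ^ n), (f p - f (p.1 - j • unitVec (fine (L ^ n * L ^ K) M) μ, p.2))) :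
    HasMaj (BlockNorm.ofBlocks (unitTorusGeo L K M) (blkFine L K M))
      (BlockNorm.ofBlocks (unitTorusGeo L K M) (fun i : Tor (fine (L ^ n * L ^ K) M) × Fin (d + 1) => blockOf (L ^ n * L ^ K) M i.1))
      (pull (kingPrV L K n M) ∘ₗ Gc ∘ₗ mulOp (blockAvg (kingPrV L K n M) χ) ∘ₗ Y)
      (fun y y' => 2 * β * B4Sect5Proof.latticeConst (d + 1) (δ / 2) * r * A * ((Real.exp δ + 1) * (((L ^ K : ℕ) : ℝ))⁻¹ + θ) *
        Real.exp (-(δ / 2 * tdistT M y y'))) := by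
  have hdd : ∀ a b : (unitTorusGeo L K M).Site, 0 ≤ (unitTorusGeo L K M).dist a b := fun a b => tdistT_nonneg M a b
  have htri : Triangle254 (unitTorusGeo L K M) := fun a b c => tdistT_triangle M a b c
  have hσ : 0 < δ / 2 := by positivity
  have hrow := rowSum_unitTorusGeo L K M hσ
  have hcr : 0 ≤ B4Sect5Proof.latticeConst (d + 1) (δ / 2) := B4Sect5Proof.latticeConst_nonneg (d + 1) hσ.le
  have hL0 : 0 < L := Nat.pos_of_ne_zero (NeZero.ne L)
  have hℓr : (0 : ℝ) < ((L ^ n : ℕ) : ℝ) := by positivity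
  have hx : (0 : ℝ) ≤ (((L ^ K : ℕ) : ℝ))⁻¹ := inv_nonneg.mpr (by positivity)
  -- `|χ| ≤ 2r`, `|χ̄| ≤ 2r`
  have hχb : ∀ p, |χ p| ≤ 2 * r := fun p => by
    rw [hχ p, abs_mul, abs_of_nonneg (inv_nonneg.mpr hℓr.le)]
    calc (((L ^ n : ℕ) : ℝ))⁻¹ * |∑ j ∈ range (L ^ n), (f p - f (p.1 - j • unitVec (fine (L ^ n * L ^ K) M) μ, p.2))|
        ≤ (((L ^ n : ℕ) : ℝ))⁻¹ * ∑ j ∈ range (L ^ n), (2 * r) := by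
          refine mul_le_mul_of_nonneg_left ((Finset.abs_sum_le_sum_abs _ _).trans (Finset.sum_le_sum fun j _ => ?_)) (inv_nonneg.mpr hℓr.le)
          calc |f p - f (p.1 - j • unitVec (fine (L ^ n * L ^ K) M) μ, p.2)| ≤ |f p| + |f (p.1 - j • unitVec (fine (L ^ n * L ^ K) M) μ, p.2)| :=
                abs_sub _ _
            _ ≤ r + r := add_le_add (hf _) (hf _)
            _ = 2 * r := by ring
      _ = 2 * r := by rw [Finset.sum_const, card_range, nsmul_eq_mul, ← mul_assoc, inv_mul_cancel₀ hℓr.ne', one_mul]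
  have hχa : ∀ q, |blockAvg (kingPrV L K n M) χ q| ≤ 2 * r := abs_blockAvg_le (kingPrV L K n M) (by positivity) hχb
  -- the three rows
  have h1 := hasMaj_front_mulOp_avg L M K n hβ hA hδ hr hM2 hG' hS' hY hDY μ hf hχ
  have h2 := hasMaj_comp_exp htri hdd hrow (by positivity : (0 : ℝ) ≤ β * (2 * r) * (((L ^ K : ℕ) : ℝ))⁻¹) hA hσ.le (by linarith : δ / 2 ≤ δ)
    (by linarith : δ / 2 + δ / 2 ≤ δ) (hGc χ (2 * r) (by positivity) hχb) hY
  have hMY := hasMaj_mulOp_comp (g := unitTorusGeo L K M) (blkFine L K M) (fun y y' => by positivity) (by positivity : (0 : ℝ) ≤ 2 * r) hχa hY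
  have h3 := hasMaj_comp_exp htri hdd hrow (by positivity : (0 : ℝ) ≤ β * θ) (by positivity : (0 : ℝ) ≤ 2 * r * A) hσ.le (by linarith : δ / 2 ≤ δ)
    (by linarith : δ / 2 + δ / 2 ≤ δ) hDG (hMY.mono fun y y' => le_of_eq (by ring))
  refine (((h1.sub h2).sub h3).congr fun v => ?_).mono fun y y' => ?_
  · simp only [LinearMap.sub_apply, LinearMap.comp_apply, idef_apply, map_sub]
    abel
  · rw [kappa_ofBlocks, unitTorusGeo_dist]
    apply le_of_eq
    ring

/-- **TERM A — THE TRUE-VERSUS-FITTED `ã`-LETTER** is a plain coarse multiplier `|g| ≤ ω` (`ω = r∕L^K` by FILE 69 `abs_shiftFit_le`) behind the coarse forward front `ḠN̄∇̄_μ ≤ βe^{−δd}`: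
`P∘(ḠN̄∇̄_μ)∘M_g∘Ȳ ≤ βc_r·ωA·e^{−(δ∕2)d}`. [cite: Balaban1985BackgroundPropagators, (3.62)–(3.65) pp.402–403 (mechanism)] -/
theorem hasMaj_pull_frontFwd_mulOp {Gc Y : Module.End ℝ (Tor (fine (L ^ K) M) × Fin (d + 1) → ℝ)} {β A δ ω : ℝ} (hβ : 0 ≤ β) (hA : 0 ≤ A) (hδ : 0 < δ)
    (hω : 0 ≤ ω) (μ : Fin (d + 1))
    (hSc : HasMaj (BlockNorm.ofBlocks (unitTorusGeo L K M) (blkFine L K M)) (BlockNorm.ofBlocks (unitTorusGeo L K M) (blkFine L K M))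
      (Gc ∘ₗ symbOp M (L ^ K) (sD M (L ^ K) μ ((L ^ K : ℕ) : ℝ))) (fun y y' => β * Real.exp (-(δ * tdistT M y y'))))
    (hY : HasMaj (BlockNorm.ofBlocks (unitTorusGeo L K M) (blkFine L K M)) (BlockNorm.ofBlocks (unitTorusGeo L K M) (blkFine L K M)) Y
      (fun y y' => A * Real.exp (-(δ * tdistT M y y'))))
    {g : Tor (fine (L ^ K) M) × Fin (d + 1) → ℝ} (hg : ∀ q, |g q| ≤ ω) :
    HasMaj (BlockNorm.ofBlocks (unitTorusGeo L K M) (blkFine L K M))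
      (BlockNorm.ofBlocks (unitTorusGeo L K M) (fun i : Tor (fine (L ^ n * L ^ K) M) × Fin (d + 1) => blockOf (L ^ n * L ^ K) M i.1))
      (pull (kingPrV L K n M) ∘ₗ (Gc ∘ₗ symbOp M (L ^ K) (sD M (L ^ K) μ ((L ^ K : ℕ) : ℝ))) ∘ₗ mulOp g ∘ₗ Y)
      (fun y y' => β * B4Sect5Proof.latticeConst (d + 1) (δ / 2) * ω * A * Real.exp (-(δ / 2 * tdistT M y y'))) := by
  have hdd : ∀ a b : (unitTorusGeo L K M).Site, 0 ≤ (unitTorusGeo L K M).dist a b := fun a b => tdistT_nonneg M a b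
  have htri : Triangle254 (unitTorusGeo L K M) := fun a b c => tdistT_triangle M a b c
  have hσ : 0 < δ / 2 := by positivity
  have hrow := rowSum_unitTorusGeo L K M hσ
  have hMY := hasMaj_mulOp_comp (g := unitTorusGeo L K M) (blkFine L K M) (fun y y' => by positivity) hω hg hY
  have h2 := hasMaj_comp_exp htri hdd hrow hβ (by positivity : (0 : ℝ) ≤ ω * A) hσ.le (by linarith : δ / 2 ≤ δ)
    (by linarith : δ / 2 + δ / 2 ≤ δ) hSc (hMY.mono fun y y' => le_of_eq (by ring))
  have h3 := hasMaj_diag_comp (g := unitTorusGeo L K M) (blkFine L K M) (fun _ => zero_le_one) (hasMaj_pull_kingPrV L M K n) h2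
  refine (h3.congr fun v => rfl).mono fun y y' => ?_
  rw [kappa_ofBlocks, unitTorusGeo_dist]
  apply le_of_eq
  ring

end Summit.QuantumFields.YangMills.BalabanUVNodes.N15.KingModel.SrcDiv

end
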